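import Mathlib.NumberTheory.EllipticDivisibilitySequence
import Mathlib.AlgebraicGeometry.EllipticCurve.DivisionPolynomial.Basic
import Mathlib.Algebra.MvPolynomial.CommRing
import HarnessLib

/-!
# Normalised elliptic divisibility sequences are elliptic nets (Xu 2026; Ward 1948)

Topic `NumberTheory/EllipticCurves`. Mathlib (this pin) defines the elliptic relator
`IsEllipticNet.rel W p q r s`, the predicate `IsEllipticNet W` (all relators vanish), the elliptic
atoms `IsEllipticNet.atom` / `IsEllipticNet.atomRel` (the symmetric form of the relator, indexed by
"doubled" indices of a common parity), and the canonical normalised EDS `normEDS b c d : ℤ → R`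
defined by the even/odd recurrences; the division polynomials of a Weierstrass curve are
`WeierstrassCurve.ψ W = normEDS ψ₂ Ψ₃ preΨ₄`. Mathlib records as a TODO the theorem that `normEDS`
is an elliptic (divisibility) sequence. This file proves the stronger statement

* `Literature.isEllipticNet_normEDS : IsEllipticNet (normEDS b c d)` for every commutative ring, and hence
* `WeierstrassCurve.isEllipticNet_ψ : IsEllipticNet W.ψ` for every Weierstrass curve,

following Junyan Xu, *On elliptic sequences over commutative rings* (2026), §2 and §4: a sequence
satisfying the even–odd recurrence with `h₂h₁` not a zero divisor satisfies *all* elliptic relations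
`E(a, b, c, d)` (Theorem 2.3, via the implication rules I.1, I.2, II.1, II.2 and Lemma 2.1), and the
general case follows by specialising the universal normalised EDS over `ℤ[X₂, X₃, X₄]` (§4, proof
of Theorem 4.1). The relations `E(a, b, c, d)` for integer or half-integer `a, b, c, d` are Mathlib's
`atomRel W A B C D` at the doubled indices `A = 2a, …` (all of one parity).

## Main statements

* `Literature.NumberTheory.EllipticCurves.EllipticNet.atomRel_ruleI₁`, `atomRel_ruleI₂`: Xu's re-indexing rules I.1, I.2.
* `Literature.NumberTheory.EllipticCurves.EllipticNet.atom_mul_atomRel_ruleII₁`, `…ruleII₁'`, `…ruleII₂`: rules II.1, II.2 (formal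
  identities among relators).
* `Literature.NumberTheory.EllipticCurves.EllipticNet.atomRel_eq_zero_of_lt`: Xu, Theorem 2.3 (with Lemma 2.1 inlined): the even/odd
  recurrences and regularity of `W 1`, `W 2` imply `atomRel W A B C D = 0` for `A > B > C > D ≥ 0`.
* `Literature.NumberTheory.EllipticCurves.EllipticNet.isEllipticNet_of_rel_even_odd`: the same, as `IsEllipticNet W`.
* `Literature.isEllipticNet_normEDS`, `Literature.isEllipticSequence_normEDS`, `WeierstrassCurve.isEllipticNet_ψ`.

## References

* [Xu2026] Junyan Xu, *On Elliptic Sequences over Commutative Rings*, arXiv:2604.05280 (2026),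
  §2 (Rules I.1, I.2, II.1, II.2, Lemma 2.1, Theorem 2.3), §4 (Theorem 4.1, universal EDS).
* [Ward1948] M. Ward, *Memoir on elliptic divisibility sequences*, Amer. J. Math. 70 (1948).
* [SilvermanAEC2009] J. H. Silverman, *The Arithmetic of Elliptic Curves*, 2nd ed., Exercise 3.7
  and Exercise 3.34 (elliptic divisibility sequences).

## Design

Helper lemmas about Mathlib's `IsEllipticNet.atom`/`atomRel`/`rel` live in `namespace Literature.EllipticNet`
(with `open IsEllipticNet`); `WeierstrassCurve.isEllipticNet_ψ` is a deliberate dot-notation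
extension. Regularity hypotheses are stated as cancellation (`∀ x, x * W 1 = 0 → x = 0`). Parities
are tracked as `X % 2 = e` with `e = 0 ∨ e = 1`, so that `omega` handles all index bookkeeping; the
half-sum `S` of Rules I.1/I.2 is introduced through `2 * S = A + B + C + D` rather than a division.
-/

universe u

open IsEllipticNet

namespace Literature.NumberTheory.EllipticCurves

namespace EllipticNet

variable {R : Type u} [CommRing R] (W : ℤ → R)

/-! ## Rules I.1 and I.2: re-indexing an elliptic relation -/

/-- **Rule I.1** (Xu 2026, §2): for indices of a common parity with half-sum `S`,
`ERₐ(S, S-C-D, S-B-D, S-B-C) = ERₐ(A, B, C, D)`; the three products of atoms are separately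
invariant. [cite: Xu2026, §2 Rule I.1] -/
theorem atomRel_ruleI₁ {A B C D S : ℤ} (hS : 2 * S = A + B + C + D) :
    atomRel W S (S - C - D) (S - B - D) (S - B - C) = atomRel W A B C D := by
  simp only [atomRel, atom]
  rw [show S + (S - C - D) = A + B by omega, show S - (S - C - D) = C + D by omega,
    show S - B - D + (S - B - C) = A - B by omega, show S - B - D - (S - B - C) = C - D by omega,
    show S + (S - B - D) = A + C by omega, show S - (S - B - D) = B + D by omega,
    show S - C - D + (S - B - C) = A - C by omega, show S - C - D - (S - B - C) = B - D by omega,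
    show S + (S - B - C) = A + D by omega, show S - (S - B - C) = B + C by omega,
    show S - C - D + (S - B - D) = A - D by omega, show S - C - D - (S - B - D) = B - C by omega]
  ring

/-- **Rule I.2** (Xu 2026, §2; Mathlib's `atomRel_avg_sub` with the half-sum made explicit): for
indices of a common parity with half-sum `S`, `ERₐ(S-D, S-C, S-B, S-A) = ERₐ(A, B, C, D)`.
[cite: Xu2026, §2 Rule I.2] -/
theorem atomRel_ruleI₂ {A B C D S : ℤ} (hS : 2 * S = A + B + C + D) :
    atomRel W (S - D) (S - C) (S - B) (S - A) = atomRel W A B C D := by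
  simp only [atomRel, atom]
  rw [show S - D + (S - C) = A + B by omega, show S - D - (S - C) = C - D by omega,
    show S - B + (S - A) = C + D by omega, show S - B - (S - A) = A - B by omega,
    show S - D + (S - B) = A + C by omega, show S - D - (S - B) = B - D by omega,
    show S - C + (S - A) = B + D by omega, show S - C - (S - A) = A - C by omega,
    show S - D + (S - A) = B + C by omega, show S - D - (S - A) = A - D by omega,
    show S - C + (S - B) = A + D by omega, show S - C - (S - B) = B - C by omega]
  ring

/-! ## Rules II.1 and II.2: linear relations among elliptic relations -/

/-- **Rule II.1** (Xu 2026, §2), first form: with `T(xy|abcd) := Wₐ(x,y)·ERₐ(a,b,c,d)`,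
`T(cd|mnrc) = T(rc|mncd) - T(nc|mrcd) + T(mc|nrcd)`; a formal identity among atoms.
[cite: Xu2026, §2 Rule II.1] -/
theorem atom_mul_atomRel_ruleII₁ (m n r c d : ℤ) :
    atom W c d * atomRel W m n r c =
      atom W r c * atomRel W m n c d - atom W n c * atomRel W m r c d +
        atom W m c * atomRel W n r c d := by
  simp only [atomRel]
  ring

/-- **Rule II.1** (Xu 2026, §2), second form: `T(cd|mnrd) = T(rd|mncd) - T(nd|mrcd) + T(md|nrcd)`.
[cite: Xu2026, §2 Rule II.1] -/
theorem atom_mul_atomRel_ruleII₁' (m n r c d : ℤ) :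
    atom W c d * atomRel W m n r d =
      atom W r d * atomRel W m n c d - atom W n d * atomRel W m r c d +
        atom W m d * atomRel W n r c d := by
  simp only [atomRel]
  ring

/-- **Rule II.2** (Xu 2026, §2): one relation from ten,
`T(cd|mnrs) = T(nd|mrsc) - T(rd|mnsc) + T(sd|mnrc) + T(nc|mrsd) - T(rc|mnsd) + T(sc|mnrd)
  + T(nr|mscd) - T(ns|mrcd) + T(rs|mncd) - 2T(md|nrsc)`; a formal identity among atoms.
[cite: Xu2026, §2 Rule II.2] -/
theorem atom_mul_atomRel_ruleII₂ (m n r s c d : ℤ) :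
    atom W c d * atomRel W m n r s =
      atom W n d * atomRel W m r s c - atom W r d * atomRel W m n s c +
        atom W s d * atomRel W m n r c +
      (atom W n c * atomRel W m r s d - atom W r c * atomRel W m n s d +
        atom W s c * atomRel W m n r d) +
      (atom W n r * atomRel W m s c d - atom W n s * atomRel W m r c d +
        atom W r s * atomRel W m n c d) -
      2 * (atom W m d * atomRel W n r s c) := by
  simp only [atomRel]
  ring

/-! ## The base relations in relator form -/

/-- The doubled base relation of the integer case is the odd recurrence:
`ERₐ(2a, 2a-2, 2, 0) = ER(a, a-1, 1, 0)`. [cite: Xu2026, proof of Thm 2.3] -/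
theorem atomRel_base_even (a : ℤ) : atomRel W (2 * a) (2 * a - 2) 2 0 = rel W a (a - 1) 1 0 := by
  rw [atomRel_eq W (a := 2 * a) (b := 2 * a - 2) (c := 2) (d := 0) ⟨by omega, by omega, by omega⟩]
  congr 1 <;> omega

/-- The doubled base relation of the half-integer case is the even recurrence:
`ERₐ(2a+1, 2a-1, 3, 1) = ER(a+1, a-1, 1, 0)` (Xu: `E(b+1, b, 3/2, 1/2)` is equivalent to
`E(b+3/2, b-1/2, 1, 0)`). [cite: Xu2026, proof of Thm 2.3] -/
theorem atomRel_base_odd (a : ℤ) :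
    atomRel W (2 * a + 1) (2 * a - 1) 3 1 = rel W (a + 1) (a - 1) 1 0 := by
  rw [atomRel_eq W (a := 2 * a + 1) (b := 2 * a - 1) (c := 3) (d := 1)
    ⟨by omega, by omega, by omega⟩,
    show (2 * a + 1 - 1) / 2 = a by omega, show (2 * a - 1 - 1) / 2 = a - 1 by omega,
    show ((3 : ℤ) - 1) / 2 = 1 by decide]
  simp only [rel]
  ring_nf

/-- Parity is invariant under `|·|`. [folklore] -/
theorem abs_emod_two (x : ℤ) : |x| % 2 = x % 2 := by
  rcases abs_choice x with h | h <;> omega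

/-! ## Xu's Theorem 2.3: the even/odd recurrences imply all elliptic relations -/

section Main

variable {W}
variable (h1 : ∀ x : R, x * W 1 = 0 → x = 0) (h2 : ∀ x : R, x * W 2 = 0 → x = 0)
  (heven : ∀ m : ℤ, rel W (m + 1) (m - 1) 1 0 = 0) (hodd : ∀ m : ℤ, rel W (m + 1) m 1 0 = 0)
include h1 h2 heven hodd

/-- **Xu 2026, Theorem 2.3 with Lemma 2.1** (doubled indices). Let `W : ℤ → R` satisfy `W 0 = 0`,
the even and odd recurrences `ER(m+1, m-1, 1, 0) = 0`, `ER(m+1, m, 1, 0) = 0` for all `m ∈ ℤ`, and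
suppose `W 1` and `W 2` are not zero divisors. Then every elliptic relation with integer or
half-integer indices holds: `ERₐ(A, B, C, D) = 0` whenever `A > B > C > D ≥ 0` have a common parity.
Proof: strong induction on `A`; the relations `ERₐ(A', B', 2+e, e)` (`e` the parity) come from the
recurrences (`B' = A'-2`) or from Rule I.2 and the induction hypothesis (`B' ≤ A'-4`), and generate
the rest through Rules II.1, II.2 (Lemma 2.1) after cancelling `Wₐ(2+e, e) = W(1+e)W(1)`.
[cite: Xu2026, Theorem 2.3 and Lemma 2.1] -/
theorem atomRel_eq_zero_of_lt {A B C D : ℤ} (hpar : A % 2 = D % 2 ∧ B % 2 = D % 2 ∧ C % 2 = D % 2)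
    (hAB : B < A) (hBC : C < B) (hCD : D < C) (hD : 0 ≤ D) : atomRel W A B C D = 0 := by
  -- strong induction on `A`, uniformly in the parity
  suffices key : ∀ (n : ℕ) (A B C D : ℤ), A < n → (A % 2 = D % 2 ∧ B % 2 = D % 2 ∧ C % 2 = D % 2) →
      B < A → C < B → D < C → 0 ≤ D → atomRel W A B C D = 0 from
    key (A.toNat + 1) A B C D (by omega) hpar hAB hBC hCD hD
  intro n
  induction n with
  | zero => intro A B C D hA _ _ _ _ _; omega
  | succ n ih =>
    intro A B C D hA hpar hAB hBC hCD hD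
    -- the parity `e ∈ {0, 1}` of the quadruple; base pair `(2 + e, e)`
    obtain ⟨e, he, heA, heB, heC, heD⟩ : ∃ e : ℤ, (e = 0 ∨ e = 1) ∧ A % 2 = e ∧ B % 2 = e ∧
        C % 2 = e ∧ D % 2 = e := ⟨D % 2, by omega, by omega, by omega, by omega, rfl⟩
    -- cancellation of the atom `Wₐ(2+e, e) = W(1+e) W(1)`
    have hreg : ∀ X : R, atom W (2 + e) e * X = 0 → X = 0 := by
      intro X hX
      rw [atom, mul_comm, ← mul_assoc] at hX
      rcases he with rfl | rfl
      · rw [show ((2 : ℤ) + 0 + 0).tdiv 2 = 1 by decide, show ((2 : ℤ) + 0 - 0).tdiv 2 = 1 by decide]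
          at hX
        exact h1 _ (h1 _ hX)
      · rw [show ((2 : ℤ) + 1 + 1).tdiv 2 = 2 by decide, show ((2 : ℤ) + 1 - 1).tdiv 2 = 1 by decide]
          at hX
        exact h2 _ (h1 _ hX)
    -- Step 1: the relations `ERₐ(A', B', 2+e, e) = 0` for `A' ≤ A`
    have H : ∀ A' B' : ℤ, A' ≤ A → A' % 2 = e → B' % 2 = e → 2 + e < B' → B' < A' →
        atomRel W A' B' (2 + e) e = 0 := by
      intro A' B' hA' hpA' hpB' hB' hA'B'
      by_cases hlt : A' < A
      · exact ih A' B' (2 + e) e (by omega) ⟨by omega, by omega, by omega⟩ hA'B' hB' (by omega)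
          (by omega)
      by_cases hfar : B' + 4 ≤ A'
      · -- Rule I.2 lowers the first index
        obtain ⟨S, hS⟩ : ∃ S : ℤ, 2 * S = A' + B' + (2 + e) + e :=
          ⟨(A' + B' + 2 + 2 * e) / 2, by omega⟩
        rw [← atomRel_ruleI₂ W hS, ← atomRel_abs₄]
        rcases le_or_gt 0 (S - A') with hsg | hsg
        · rw [abs_of_nonneg hsg]
          exact ih _ _ _ _ (by omega) ⟨by omega, by omega, by omega⟩ (by omega) (by omega)
            (by omega) hsg
        · rw [abs_of_neg hsg]
          exact ih _ _ _ _ (by omega) ⟨by omega, by omega, by omega⟩ (by omega) (by omega)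
            (by omega) (by omega)
      · -- `B' = A' - 2`: the defining recurrences
        rcases he with rfl | rfl
        · obtain ⟨a, rfl⟩ : ∃ a : ℤ, A' = 2 * a := ⟨A' / 2, by omega⟩
          rw [show B' = 2 * a - 2 by omega, show (2 : ℤ) + 0 = 2 by rfl, atomRel_base_even,
            show a = (a - 1) + 1 by ring, add_sub_cancel_right]
          exact hodd (a - 1)
        · obtain ⟨a, rfl⟩ : ∃ a : ℤ, A' = 2 * a + 1 := ⟨A' / 2, by omega⟩
          rw [show B' = 2 * a - 1 by omega, show (2 : ℤ) + 1 = 3 by rfl, atomRel_base_odd]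
          exact heven a
    -- Step 2 (Lemma 2.1, first part): `ERₐ(A', B', C', 2+e) = 0` and `ERₐ(A', B', C', e) = 0`
    have H1C : ∀ A' B' C' : ℤ, A' ≤ A → A' % 2 = e → B' % 2 = e → C' % 2 = e → 2 + e < C' →
        C' < B' → B' < A' → atomRel W A' B' C' (2 + e) = 0 := by
      intro A' B' C' hA' hpA' hpB' hpC' hC' hB'C' hA'B'
      apply hreg
      rw [atom_mul_atomRel_ruleII₁, H A' B' hA' hpA' hpB' (by omega) hA'B',
        H A' C' hA' hpA' hpC' hC' (by omega), H B' C' (by omega) hpB' hpC' hC' hB'C']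
      ring
    have H1D : ∀ A' B' C' : ℤ, A' ≤ A → A' % 2 = e → B' % 2 = e → C' % 2 = e → 2 + e < C' →
        C' < B' → B' < A' → atomRel W A' B' C' e = 0 := by
      intro A' B' C' hA' hpA' hpB' hpC' hC' hB'C' hA'B'
      apply hreg
      rw [atom_mul_atomRel_ruleII₁', H A' B' hA' hpA' hpB' (by omega) hA'B',
        H A' C' hA' hpA' hpC' hC' (by omega), H B' C' (by omega) hpB' hpC' hC' hB'C']
      ring
    -- Step 3 (Lemma 2.1, second part): `ERₐ(A', B', C', D') = 0` for `D' > 2 + e`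
    have H2 : ∀ A' B' C' D' : ℤ, A' ≤ A → A' % 2 = e → B' % 2 = e → C' % 2 = e → D' % 2 = e →
        2 + e < D' → D' < C' → C' < B' → B' < A' → atomRel W A' B' C' D' = 0 := by
      intro A' B' C' D' hA' hpA' hpB' hpC' hpD' hD' hC'D' hB'C' hA'B'
      apply hreg
      rw [atom_mul_atomRel_ruleII₂,
        H1C A' C' D' hA' hpA' hpC' hpD' hD' hC'D' (by omega),
        H1C A' B' D' hA' hpA' hpB' hpD' hD' (by omega) hA'B',
        H1C A' B' C' hA' hpA' hpB' hpC' (by omega) hB'C' hA'B',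
        H1D A' C' D' hA' hpA' hpC' hpD' hD' hC'D' (by omega),
        H1D A' B' D' hA' hpA' hpB' hpD' hD' (by omega) hA'B',
        H1D A' B' C' hA' hpA' hpB' hpC' (by omega) hB'C' hA'B',
        H A' D' hA' hpA' hpD' hD' (by omega), H A' C' hA' hpA' hpC' (by omega) (by omega),
        H A' B' hA' hpA' hpB' (by omega) hA'B',
        H1C B' C' D' (by omega) hpB' hpC' hpD' hD' hC'D' hB'C']
      ring
    -- Assembly: `D = e`, `D = 2 + e`, or `D > 2 + e`
    by_cases hDe : D = e
    · subst hDe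
      by_cases hCe : C = 2 + D
      · subst hCe
        exact H A B le_rfl heA heB hBC hAB
      · exact H1D A B C le_rfl heA heB heC (by omega) hBC hAB
    by_cases hDe' : D = 2 + e
    · subst hDe'
      exact H1C A B C le_rfl heA heB heC hCD hBC hAB
    · exact H2 A B C D le_rfl heA heB heC heD (by omega) hCD hBC hAB

/-- Under the hypotheses of `atomRel_eq_zero_of_lt` and oddness of `W`, *every* symmetric relator
with indices of a common parity vanishes (any signs, any order, repetitions allowed): reduce to
`A > B > C > D ≥ 0` using `|·|` (oddness), the sign changes under transpositions of arguments, and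
the degenerate cases `ERₐ(a, a, b, c) = W(a)W(0)·Wₐ(b, c) = 0`. [cite: Xu2026, §2 (paragraph before
the Remark) and Theorem 2.3] -/
theorem atomRel_eq_zero (h0 : W 0 = 0) (hW : Function.Odd W) {A B C D : ℤ}
    (hpar : A % 2 = D % 2 ∧ B % 2 = D % 2 ∧ C % 2 = D % 2) : atomRel W A B C D = 0 := by
  -- sign changes under adjacent transpositions, invariance under `(A B) (C D) ↦ (C D) (A B)`
  have swap₁₂ : ∀ a b c d : ℤ, atomRel W b a c d = -atomRel W a b c d := fun a b c d => by
    simp only [atomRel]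
    rw [← neg_atom hW a b]
    ring
  have swap₂₃ : ∀ a b c d : ℤ, atomRel W a c b d = -atomRel W a b c d := fun a b c d => by
    simp only [atomRel]
    rw [← neg_atom hW b c]
    ring
  have swap₃₄ : ∀ a b c d : ℤ, atomRel W a b d c = -atomRel W a b c d := fun a b c d => by
    simp only [atomRel]
    rw [← neg_atom hW c d]
    ring
  have swap₁₃₂₄ : ∀ a b c d : ℤ, atomRel W c d a b = atomRel W a b c d := fun a b c d => by
    simp only [atomRel]
    rw [atom_mul_atom hW c a d b, atom_mul_atom hW c b d a]
    ring
  -- sorted quadruples (with possible repetitions)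
  have sorted : ∀ a b c d : ℤ, (a % 2 = d % 2 ∧ b % 2 = d % 2 ∧ c % 2 = d % 2) →
      b ≤ a → c ≤ b → d ≤ c → 0 ≤ d → atomRel W a b c d = 0 := by
    intro a b c d hp hab hbc hcd hd
    rcases hab.lt_or_eq with hab | rfl
    · rcases hbc.lt_or_eq with hbc | rfl
      · rcases hcd.lt_or_eq with hcd | rfl
        · exact atomRel_eq_zero_of_lt h1 h2 heven hodd hp hab hbc hcd hd
        · rw [atomRel_same₃₄, h0, mul_zero, zero_mul]
      · rw [atomRel_same₂₃, h0, mul_zero, zero_mul]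
    · rw [atomRel_same₁₂, h0, mul_zero, zero_mul]
  -- quadruples with `a` maximal, `b ≤ a`, `d ≤ c ≤ a`
  have hmax : ∀ a b c d : ℤ, (a % 2 = d % 2 ∧ b % 2 = d % 2 ∧ c % 2 = d % 2) →
      0 ≤ b → 0 ≤ d → b ≤ a → d ≤ c → c ≤ a → atomRel W a b c d = 0 := by
    intro a b c d hp hb hd hab hcd hca
    rcases le_or_gt c b with hcb | hbc
    · exact sorted a b c d hp hab hcb hcd hd
    rcases le_or_gt d b with hdb | hbd
    · have := sorted a c b d ⟨hp.1, hp.2.2, hp.2.1⟩ hca hbc.le hdb hd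
      rwa [swap₂₃, neg_eq_zero] at this
    · have := sorted a c d b ⟨by omega, by omega, by omega⟩ hca hcd hbd.le hb
      rwa [swap₃₄, swap₂₃, neg_neg] at this
  -- quadruples with `b ≤ a`, `d ≤ c`
  have hpairs : ∀ a b c d : ℤ, (a % 2 = d % 2 ∧ b % 2 = d % 2 ∧ c % 2 = d % 2) →
      0 ≤ b → 0 ≤ d → b ≤ a → d ≤ c → atomRel W a b c d = 0 := by
    intro a b c d hp hb hd hab hcd
    rcases le_or_gt c a with hca | hac
    · exact hmax a b c d hp hb hd hab hcd hca
    · rw [← swap₁₃₂₄]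
      exact hmax c d a b ⟨by omega, by omega, by omega⟩ hd hb hcd hab hac.le
  -- nonnegative quadruples
  have hnonneg : ∀ a b c d : ℤ, (a % 2 = d % 2 ∧ b % 2 = d % 2 ∧ c % 2 = d % 2) →
      0 ≤ a → 0 ≤ b → 0 ≤ c → 0 ≤ d → atomRel W a b c d = 0 := by
    intro a b c d hp ha hb hc hd
    rcases le_or_gt b a with hab | hab <;> rcases le_or_gt d c with hcd | hcd
    · exact hpairs a b c d hp hb hd hab hcd
    · rw [← neg_eq_zero, ← swap₃₄]
      exact hpairs a b d c ⟨by omega, by omega, by omega⟩ hb hc hab hcd.le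
    · rw [← neg_eq_zero, ← swap₁₂]
      exact hpairs b a c d ⟨by omega, by omega, by omega⟩ ha hd hab.le hcd
    · rw [← neg_eq_zero, ← swap₁₂, ← neg_eq_zero, ← swap₃₄]
      exact hpairs b a d c ⟨by omega, by omega, by omega⟩ ha hc hab.le hcd.le
  -- reduce to nonnegative indices
  rw [← atomRel_abs₁ hW, ← atomRel_abs₂ hW, ← atomRel_abs₃ hW, ← atomRel_abs₄]
  refine hnonneg |A| |B| |C| |D| ?_ (abs_nonneg A) (abs_nonneg B) (abs_nonneg C) (abs_nonneg D)
  simp only [abs_emod_two]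
  exact hpar

/-- **Xu 2026, Theorem 2.3** in Mathlib's language: a sequence `W : ℤ → R` with `W 0 = 0`,
`W (-n) = -W n`, `W 1` and `W 2` not zero divisors, satisfying the even and odd recurrences
`ER(m+1, m-1, 1, 0) = 0` and `ER(m+1, m, 1, 0) = 0` for all `m ∈ ℤ`, is an elliptic net:
`ER(p, q, r, s) = 0` for all `p q r s ∈ ℤ`. [cite: Xu2026, Theorem 2.3] -/
theorem isEllipticNet_of_rel_even_odd (h0 : W 0 = 0) (hW : Function.Odd W) : IsEllipticNet W :=
    fun p q r s => by
  rw [rel_eq]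
  exact atomRel_eq_zero h1 h2 heven hodd h0 hW ⟨by omega, by omega, by omega⟩

end Main

/-! ## Normalised EDSs and division polynomials are elliptic nets -/

open MvPolynomial in
/-- **Standard EDSs are elliptic** (Xu 2026, Theorem 4.1; the elliptic relations of Ward 1948):
for every commutative ring `R` and `b c d ∈ R`, the normalised EDS `W = normEDS b c d`
(`W 0 = 0`, `W 1 = 1`, `W 2 = b`, `W 3 = c`, `W 4 = d b`, even/odd recurrences) satisfies every
elliptic relation `ER(p, q, r, s) = 0`. Proof: for the universal parameters `X₀, X₁, X₂` over
`ℤ[X₀, X₁, X₂]` (a domain, `W 2 = X₀ ≠ 0`) this is `isEllipticNet_of_rel_even_odd`; the general case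
follows by the specialisation `Xᵢ ↦ (b, c, d)` (`map_normEDS`, `map_rel`). This settles the
Mathlib TODO "prove that `normEDS` satisfies `IsEllipticDvdSequence`" (elliptic part).
[cite: Xu2026, Theorem 4.1] -/
theorem isEllipticNet_normEDS {R : Type u} [CommRing R] (b c d : R) :
    IsEllipticNet (normEDS b c d) := by
  -- the universal case
  have huniv : IsEllipticNet (normEDS (X 0 : MvPolynomial (Fin 3) ℤ) (X 1) (X 2)) := by
    refine isEllipticNet_of_rel_even_odd (fun x hx => ?_) (fun x hx => ?_) (fun m => ?_)
      (fun m => ?_) (normEDS_zero _ _ _) (fun n => normEDS_neg _ _ _ n)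
    · simpa using hx
    · rw [normEDS_two] at hx
      exact (mul_eq_zero.mp hx).resolve_right (X_ne_zero _)
    · rw [rel_even, normEDS_one, normEDS_two, normEDS_even]
      ring
    · rw [rel_odd, normEDS_one, normEDS_odd]
      ring
  -- specialisation
  intro p q r s
  have h := congrArg (MvPolynomial.aeval (R := ℤ) (S₁ := R) ![b, c, d]) (huniv p q r s)
  rw [IsEllipticNet.map_rel, map_zero] at h
  convert h using 2
  funext n
  simp only [Function.comp_apply, map_normEDS, MvPolynomial.aeval_X, Matrix.cons_val_zero,
    Matrix.cons_val_one, Matrix.cons_val_two, Matrix.tail_cons, Matrix.head_cons]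

/-- Normalised EDSs are elliptic sequences (`ER(p, q, r, 0) = 0`), the elliptic half of Mathlib's
TODO `IsEllipticDvdSequence (normEDS b c d)`. [cite: Xu2026, Theorem 4.1] -/
theorem isEllipticSequence_normEDS {R : Type u} [CommRing R] (b c d : R) :
    IsEllipticSequence (normEDS b c d) :=
  (isEllipticNet_normEDS b c d).isEllipticSequence

end EllipticNet

end Literature.NumberTheory.EllipticCurves

namespace WeierstrassCurve

open Polynomial in
/-- **The division polynomials of a Weierstrass curve form an elliptic net**: for every
Weierstrass curve `W` over a commutative ring, the bivariate division polynomials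
`ψₙ ∈ R[X][Y]` (Mathlib's `WeierstrassCurve.ψ`, the normalised EDS with `ψ₂ = 2Y + a₁X + a₃`,
`ψ₃`, `ψ₄ = ψ₂ · preΨ₄`) satisfy all elliptic relations
`ψ_{p+q+s} ψ_{p-q} ψ_{r+s} ψ_r - ψ_{p+r+s} ψ_{p-r} ψ_{q+s} ψ_q + ψ_{q+r+s} ψ_{q-r} ψ_{p+s} ψ_p = 0`,
in particular `ψ_{m+n} ψ_{m-n} ψ_r² = ψ_{m+r} ψ_{m-r} ψ_n² - ψ_{n+r} ψ_{n-r} ψ_m²`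
(Silverman, *AEC*, Exercise 3.7(g) for `r = 1`; Ward 1948). Deliberate dot-notation extension of
Mathlib's `WeierstrassCurve`. [cite: Xu2026, Theorem 4.1 and §1 Remark] -/
theorem isEllipticNet_ψ {R : Type u} [CommRing R] (W : WeierstrassCurve R) : IsEllipticNet W.ψ :=
  Literature.NumberTheory.EllipticCurves.EllipticNet.isEllipticNet_normEDS _ _ _

end WeierstrassCurve
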